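import Summits.RiemannHypothesis.RiemannHypothesis.Theorems.Splittings.JensenX4NewmanAllDeriv
import Summits.RiemannHypothesis.RiemannHypothesis.Theorems.Splittings.JensenX4NewmanDict
import Literature.NumberTheory.LFunctions.KiKimLeeProofs
import Literature.NumberTheory.LFunctions.EquivalentsProofs

/-!
# Splittings — X-4 × NEWMAN FOR EVERY DERIVATIVE, part 3/3: the Ki–Kim–Lee chain `0 ≤ λ_{m+1} ≤ λ_m ≤ Λ < 1/2`,
# closedness / attainment, and `A = RowsFromOne ⟺ λ_1 = 0` (SPLIT-jen-neg gen 6; zero-definition raw form)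

Cell rh-split (brief sha16 f79c5f09d8bcb036), seat rh-split-jen-neg g6 (planner-rh-split-jen-neg-g6-0), card
`run/shared/lean/pub/rh-split/cards/SPLIT-jen-neg.md` ADDENDUM 7 (booked by the lead, ruling #42, 07:01Z; PRE-FILE OFFER accepted as
lane (xvi)); cut by the seat from `HOME/rh-split-jen-neg/g6/SketchG6AllDerivDelta.lean` (revision 3; declarations byte-identical to it;
the seat's combined file checks rc 0 / 0 warnings / 0 sorries on the farm, standard axioms).  THREE-FILE split forced by the 400-line
rule: part 1 = §G6.1–G6.3 (`Splittings/JensenX4NewmanAllDerivPsi.lean`), part 2 = §G6.4–G6.6 (`Splittings/JensenX4NewmanAllDeriv.lean`),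
part 3 = §G6.7–G6.9 (`Splittings/JensenX4KiKimLeeChain.lean`); namespace `…Splittings.JensenX4NewmanAllDeriv` in all three.

Content of this part (`λ_m := sInf {t : ℝ | HasOnlyRealZeros (iteratedDeriv m (deBruijnH t))}`, the Ki–Kim–Lee 2009 constant of order
`m` in the tree's normalisation, `λ_0 = deBruijnNewmanConst`).  §G6.7 the sets `{t | H_t^{(m)} hyperbolic}` are bounded below by `0`
(part 2) and contain `1/2` (de Bruijn + ladder), so `kiKimLee_const_succ_le : λ_{m+1} ≤ λ_m`, `kiKimLee_const_mem_Icc : λ_m ∈ [0, Λ]`,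
`kiKimLee_const_lt_one_half`, `kiKimLee_const_eq_zero_of_hasOnlyRealZeros : H_0^{(m)} hyperbolic → λ_m = 0`, `kiKimLee_const_eq_zero_of_rh`;
§G6.8 CLOSEDNESS (Hurwitz, via the tree's `HasOnlyRealZeros.isClosed_setOf`; joint continuity of `(t, z) ↦ H_t^{(m)}(z)` by Weierstrass
`TendstoLocallyUniformlyOn.deriv`): `isClosed_setOf_hasOnlyRealZeros_iteratedDeriv`, attainment `kiKimLee_const_mem`, and
`hasOnlyRealZeros_iteratedDeriv_zero_iff_kiKimLee_const_eq_zero / _nonpos : H_0^{(m)} hyperbolic ↔ λ_m = 0 ↔ λ_m ≤ 0` — the derivative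
analogue, for every `m`, of the tree's `RH ↔ Λ ≤ 0` (recovered at `m = 0`); §G6.9 with gen 4's dictionary
`JensenX4NewmanDict.rowsFromOne_iff_hasOnlyRealZeros_deriv_deBruijnH_zero`: `rowsFromOne_iff_forall_hasOnlyRealZeros_iteratedDeriv`
(`A ↔ ∀ m ≥ 1, H_0^{(m)} hyperbolic`), `rowsFromOne_iff_kiKimLee_const_one_eq_zero : A ↔ λ_1 = 0`, `… ↔ λ_1 ≤ 0`, and the neg-lens reading
`rowsFromOne_and_not_rh_iff : (A ∧ ¬ RiemannHypothesis) ↔ (λ_1 = 0 ∧ 0 < deBruijnNewmanConst)` (no claim about which side holds).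

HONEST LABEL: «SPLITTING SEARCH over kernel-typed RH-EQUIVALENCES; a splitting A ∧ B ⟹ RH is CONDITIONAL bookkeeping unless A and B are
both proved; nothing here bears on the truth of RH.»
-/

set_option linter.dupNamespace false

noncomputable section

open Complex Filter Set Topology Metric

namespace Summit.RiemannHypothesis.RiemannHypothesis.Theorems.Splittings.JensenX4NewmanAllDeriv

open Literature Literature.NumberTheory.LFunctions
open Summit.RiemannHypothesis.RiemannHypothesis.Theorems.Splittings.JensenX4NewmanDeriv

/-! ## G6.7  The Ki–Kim–Lee constants `λ_m = inf {t | H_t^{(m)} hyperbolic}`: `0 ≤ λ_{m+1} ≤ λ_m ≤ Λ < 1/2`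

With G6.5 (`λ_m ≥ 0`, Newman's conjecture for derivatives) and G6.6 (the ladder) the `sInf`'s are
over non-empty (`1/2 ∈`) sets bounded below (by `0`), so the chain is an honest chain of real numbers:
KKL 2009 (i) `Λ^{(0)} ≥ Λ^{(1)} ≥ ⋯` plus the new floor `Λ^{(m)} ≥ 0`; and each A-type rung
`H_0^{(m)}` hyperbolic pins `λ_m = 0` (the rung is NEWMAN-CRITICAL: true "just barely" if at all). -/

/-- `{t | H_t^{(m)} hyperbolic}` is bounded below by `0` (G6.5). -/
theorem bddBelow_setOf_hasOnlyRealZeros_iteratedDeriv (m : ℕ) :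
    BddBelow {t : ℝ | HasOnlyRealZeros (iteratedDeriv m (deBruijnH t))} :=
  ⟨0, fun t ht ↦ nonneg_of_hasOnlyRealZeros_iteratedDeriv m t ht⟩

/-- `{t | H_t^{(m)} hyperbolic}` is non-empty (`1/2 ∈`, G6.6). -/
theorem nonempty_setOf_hasOnlyRealZeros_iteratedDeriv (m : ℕ) :
    {t : ℝ | HasOnlyRealZeros (iteratedDeriv m (deBruijnH t))}.Nonempty :=
  ⟨1 / 2, one_half_mem_setOf_hasOnlyRealZeros_iteratedDeriv m⟩

/-- Above `λ_m` every `H_t^{(m)}` is hyperbolic?  No monotonicity in `t` is claimed here; what the ladder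
gives is the set inclusion `{t | H_t^{(m)} hyp.} ⊆ {t | H_t^{(m+1)} hyp.}`. -/
theorem setOf_hasOnlyRealZeros_iteratedDeriv_subset_succ (m : ℕ) :
    {t : ℝ | HasOnlyRealZeros (iteratedDeriv m (deBruijnH t))} ⊆
      {t : ℝ | HasOnlyRealZeros (iteratedDeriv (m + 1) (deBruijnH t))} :=
  fun t ht ↦ hasOnlyRealZeros_iteratedDeriv_succ t m ht

/-- **KKL (i) in the kernel: `λ_{m+1} ≤ λ_m`.** -/
theorem kiKimLee_const_succ_le (m : ℕ) :
    sInf {t : ℝ | HasOnlyRealZeros (iteratedDeriv (m + 1) (deBruijnH t))} ≤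
      sInf {t : ℝ | HasOnlyRealZeros (iteratedDeriv m (deBruijnH t))} :=
  csInf_le_csInf (bddBelow_setOf_hasOnlyRealZeros_iteratedDeriv (m + 1))
    (nonempty_setOf_hasOnlyRealZeros_iteratedDeriv m)
    (setOf_hasOnlyRealZeros_iteratedDeriv_subset_succ m)

/-- `m ↦ λ_m` is antitone. -/
theorem kiKimLee_const_antitone :
    Antitone (fun m : ℕ ↦ sInf {t : ℝ | HasOnlyRealZeros (iteratedDeriv m (deBruijnH t))}) :=
  antitone_nat_of_succ_le kiKimLee_const_succ_le

/-- **`λ_m ≤ λ_0 = Λ`** (the tree's `deBruijnNewmanConst`). -/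
theorem kiKimLee_const_le_deBruijnNewmanConst (m : ℕ) :
    sInf {t : ℝ | HasOnlyRealZeros (iteratedDeriv m (deBruijnH t))} ≤ deBruijnNewmanConst := by
  have h := kiKimLee_const_antitone (Nat.zero_le m)
  simpa [iteratedDeriv_zero, deBruijnNewmanConst] using h

/-- **`0 ≤ λ_m ≤ Λ`**: every Ki–Kim–Lee constant is squeezed between Newman's floor (G6.5) and `Λ`. -/
theorem kiKimLee_const_mem_Icc (m : ℕ) :
    sInf {t : ℝ | HasOnlyRealZeros (iteratedDeriv m (deBruijnH t))} ∈ Set.Icc 0 deBruijnNewmanConst :=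
  ⟨kiKimLee_const_nonneg m, kiKimLee_const_le_deBruijnNewmanConst m⟩

/-- **`λ_m < 1/2`** (Ki–Kim–Lee's `Λ < 1/2`, tree fact `deBruijnNewmanConst_lt_one_half`, + the ladder). -/
theorem kiKimLee_const_lt_one_half (m : ℕ) :
    sInf {t : ℝ | HasOnlyRealZeros (iteratedDeriv m (deBruijnH t))} < 1 / 2 :=
  (kiKimLee_const_le_deBruijnNewmanConst m).trans_lt deBruijnNewmanConst_lt_one_half

/-- **An A-type rung pins its constant at the critical value: `H_0^{(m)}` hyperbolic ⟹ `λ_m = 0`.** -/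
theorem kiKimLee_const_eq_zero_of_hasOnlyRealZeros (m : ℕ)
    (h : HasOnlyRealZeros (iteratedDeriv m (deBruijnH 0))) :
    sInf {t : ℝ | HasOnlyRealZeros (iteratedDeriv m (deBruijnH t))} = 0 :=
  le_antisymm (csInf_le (bddBelow_setOf_hasOnlyRealZeros_iteratedDeriv m) h) (kiKimLee_const_nonneg m)

/-- **RH ⟹ `λ_m = 0` for every `m`** (all the Ki–Kim–Lee constants vanish under RH). -/
theorem kiKimLee_const_eq_zero_of_rh (hRH : _root_.RiemannHypothesis) (m : ℕ) :
    sInf {t : ℝ | HasOnlyRealZeros (iteratedDeriv m (deBruijnH t))} = 0 :=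
  kiKimLee_const_eq_zero_of_hasOnlyRealZeros m (hasOnlyRealZeros_iteratedDeriv_of_rh hRH m)

/-- **RH ⟺ `λ_0 ≤ 0` ⟹ all `λ_m ≤ 0`; and `λ_m ≤ 0 ⟺ λ_m = 0`** — the last equivalence is the content of
Newman's conjecture for derivatives (G6.5). -/
theorem kiKimLee_const_nonpos_iff_eq_zero (m : ℕ) :
    sInf {t : ℝ | HasOnlyRealZeros (iteratedDeriv m (deBruijnH t))} ≤ 0 ↔
      sInf {t : ℝ | HasOnlyRealZeros (iteratedDeriv m (deBruijnH t))} = 0 :=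
  ⟨fun h ↦ le_antisymm h (kiKimLee_const_nonneg m), fun h ↦ h.le⟩

/-! ## G6.8  Closedness in `t` (Hurwitz) and attainment: `λ_m ∈ {t | H_t^{(m)} hyperbolic}`, hence `A_m ⟺ λ_m = 0 ⟺ λ_m ≤ 0`

The tree's general closedness lemma `HasOnlyRealZeros.isClosed_setOf` (Hurwitz) applies to the family
`t ↦ H_t^{(m)}` once `(t, z) ↦ H_t^{(m)}(z)` is jointly continuous; joint continuity passes from `H`
to its `z`-derivatives by Weierstrass (`TendstoLocallyUniformlyOn.deriv`) and the tree's
`tendstoLocallyUniformlyOn_of_continuous_uncurry`.  So each `λ_m` is ATTAINED, and the derivative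
analogue of the tree's `RH ↔ Λ ≤ 0` holds for every `m`: `H_0^{(m)}` hyperbolic `↔ λ_m ≤ 0 ↔ λ_m = 0`. -/

section Closedness

/-- Joint continuity of a family of entire functions passes to the family of derivatives. -/
theorem continuous_uncurry_deriv {X : Type*} [TopologicalSpace X] {H : X → ℂ → ℂ}
    (hdiff : ∀ t, Differentiable ℂ (H t)) (hcont : Continuous (Function.uncurry H)) :
    Continuous (Function.uncurry fun t ↦ deriv (H t)) := by
  refine continuous_iff_continuousAt.2 fun p ↦ ?_
  obtain ⟨t₀, z₀⟩ := p
  have h1 : TendstoLocallyUniformlyOn H (H t₀) (𝓝 t₀) univ :=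
    tendstoLocallyUniformlyOn_of_continuous_uncurry hcont t₀ isOpen_univ
  have h2 : TendstoLocallyUniformlyOn (deriv ∘ H) (deriv (H t₀)) (𝓝 t₀) univ :=
    h1.deriv (Eventually.of_forall fun t ↦ (hdiff t).differentiableOn) isOpen_univ
  have h3 : TendstoLocallyUniformlyOn (fun q : X × ℂ ↦ deriv (H q.1)) (deriv (H t₀))
      (𝓝 (t₀, z₀)) univ := by
    intro u hu x hx
    obtain ⟨s, hs, hev⟩ := h2 u hu x hx
    exact ⟨s, hs, (continuous_fst.tendsto (t₀, z₀)).eventually hev⟩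
  have hd : Differentiable ℂ (deriv (H t₀)) :=
    differentiableOn_univ.1 ((hdiff t₀).differentiableOn.deriv isOpen_univ)
  have hcz : ContinuousWithinAt (deriv (H t₀)) univ z₀ :=
    hd.continuous.continuousAt.continuousWithinAt
  have hg : Tendsto (fun q : X × ℂ ↦ q.2) (𝓝 (t₀, z₀)) (𝓝[univ] z₀) := by
    rw [nhdsWithin_univ]
    exact continuous_snd.tendsto (t₀, z₀)
  exact h3.tendsto_comp hcz (mem_univ _) hg

/-- `(t, z) ↦ H_t^{(m)}(z)` is jointly continuous. -/
theorem continuous_uncurry_iteratedDeriv_deBruijnH (m : ℕ) :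
    Continuous (Function.uncurry fun t : ℝ ↦ iteratedDeriv m (deBruijnH t)) := by
  induction m with
  | zero =>
    have h : (Function.uncurry fun t : ℝ ↦ iteratedDeriv 0 (deBruijnH t)) =
        fun p : ℝ × ℂ ↦ deBruijnH p.1 p.2 := by
      funext p
      simp only [Function.uncurry, iteratedDeriv_zero]
    rw [h]
    exact continuous_deBruijnH_uncurry
  | succ m ih =>
    have h : (Function.uncurry fun t : ℝ ↦ iteratedDeriv (m + 1) (deBruijnH t)) =
        Function.uncurry fun t : ℝ ↦ deriv (iteratedDeriv m (deBruijnH t)) := by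
      funext p; simp [iteratedDeriv_succ]
    rw [h]
    exact continuous_uncurry_deriv (fun t ↦ differentiable_iteratedDeriv_deBruijnH t m) ih

/-- **`{t | H_t^{(m)} hyperbolic}` is closed** (Hurwitz, via the tree's `HasOnlyRealZeros.isClosed_setOf`). -/
theorem isClosed_setOf_hasOnlyRealZeros_iteratedDeriv (m : ℕ) :
    IsClosed {t : ℝ | HasOnlyRealZeros (iteratedDeriv m (deBruijnH t))} :=
  HasOnlyRealZeros.isClosed_setOf (fun t ↦ differentiable_iteratedDeriv_deBruijnH t m)
    (continuous_uncurry_iteratedDeriv_deBruijnH m) (fun t ↦ exists_iteratedDeriv_deBruijnH_ne_zero t m)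

/-- **Attainment: `λ_m ∈ {t | H_t^{(m)} hyperbolic}`**, i.e. `H_{λ_m}^{(m)}` is hyperbolic. -/
theorem kiKimLee_const_mem (m : ℕ) :
    sInf {t : ℝ | HasOnlyRealZeros (iteratedDeriv m (deBruijnH t))} ∈
      {t : ℝ | HasOnlyRealZeros (iteratedDeriv m (deBruijnH t))} :=
  (isClosed_setOf_hasOnlyRealZeros_iteratedDeriv m).csInf_mem
    (nonempty_setOf_hasOnlyRealZeros_iteratedDeriv m) (bddBelow_setOf_hasOnlyRealZeros_iteratedDeriv m)

/-- `H_{λ_m}^{(m)}` has only real zeros. -/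
theorem hasOnlyRealZeros_iteratedDeriv_kiKimLee_const (m : ℕ) :
    HasOnlyRealZeros (iteratedDeriv m
      (deBruijnH (sInf {t : ℝ | HasOnlyRealZeros (iteratedDeriv m (deBruijnH t))}))) :=
  kiKimLee_const_mem m

/-- **`A_m ⟺ λ_m = 0`**: `H_0^{(m)}` is hyperbolic iff the `m`-th Ki–Kim–Lee constant vanishes
(the derivative analogue, for every `m`, of the tree's `RH ↔ Λ = 0`-given-`Λ ≥ 0`). -/
theorem hasOnlyRealZeros_iteratedDeriv_zero_iff_kiKimLee_const_eq_zero (m : ℕ) :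
    HasOnlyRealZeros (iteratedDeriv m (deBruijnH 0)) ↔
      sInf {t : ℝ | HasOnlyRealZeros (iteratedDeriv m (deBruijnH t))} = 0 := by
  refine ⟨kiKimLee_const_eq_zero_of_hasOnlyRealZeros m, fun h ↦ ?_⟩
  have hmem := kiKimLee_const_mem m
  rwa [h] at hmem

/-- **`A_m ⟺ λ_m ≤ 0`** (the derivative analogue of the tree's `RH ↔ Λ ≤ 0`,
`riemannHypothesis_iff_deBruijnNewmanConst_nonpos`). -/
theorem hasOnlyRealZeros_iteratedDeriv_zero_iff_kiKimLee_const_nonpos (m : ℕ) :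
    HasOnlyRealZeros (iteratedDeriv m (deBruijnH 0)) ↔
      sInf {t : ℝ | HasOnlyRealZeros (iteratedDeriv m (deBruijnH t))} ≤ 0 := by
  rw [hasOnlyRealZeros_iteratedDeriv_zero_iff_kiKimLee_const_eq_zero, kiKimLee_const_nonpos_iff_eq_zero]

/-- `m = 0`: the tree's `RH ↔ Λ ≤ 0`, recovered (sanity check of the normalisation `λ_0 = Λ`). -/
theorem riemannHypothesis_iff_kiKimLee_const_zero_nonpos :
    _root_.RiemannHypothesis ↔ sInf {t : ℝ | HasOnlyRealZeros (iteratedDeriv 0 (deBruijnH t))} ≤ 0 := by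
  rw [← hasOnlyRealZeros_iteratedDeriv_zero_iff_kiKimLee_const_nonpos, iteratedDeriv_zero]
  exact riemannHypothesis_iff_hasOnlyRealZeros_deBruijnH_zero_holds

end Closedness

/-! ## G6.9  Back to splitting X-4: conjunct `A = RowsFromOne` carries the whole derivative ladder

With the tree's kernel dictionary `JensenX4NewmanDict.rowsFromOne_iff_hasOnlyRealZeros_deriv_deBruijnH_zero`
(`A ⟺ H_0′` hyperbolic) and the ladder G6.6: `A ⟺ (∀ m ≥ 1, H_0^{(m)} hyperbolic)`, and `A ⟹ λ_m = 0`
for every `m ≥ 1` — conjunct `A` of X-4 sits exactly at the common critical value of ALL the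
Ki–Kim–Lee constants `λ_1, λ_2, …` (each `≥ 0` unconditionally by G6.5). -/

section SplittingX4

open Polynomial
open Summit.RiemannHypothesis.RiemannHypothesis.Theorems.Splittings.JensenX4NewmanDict

/-- **`A = RowsFromOne` ⟺ every derivative `H_0^{(m)}`, `m ≥ 1`, is hyperbolic.** -/
theorem rowsFromOne_iff_forall_hasOnlyRealZeros_iteratedDeriv :
    (∀ d n : ℕ, 1 ≤ n → (jensenPoly xiTaylorCoeff d n).Splits) ↔
      ∀ m : ℕ, 1 ≤ m → HasOnlyRealZeros (iteratedDeriv m (deBruijnH 0)) := by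
  rw [rowsFromOne_iff_hasOnlyRealZeros_deriv_deBruijnH_zero]
  constructor
  · intro h m hm
    exact hasOnlyRealZeros_iteratedDeriv_mono 0 hm (by rwa [iteratedDeriv_one])
  · intro h
    rw [← iteratedDeriv_one]
    exact h 1 le_rfl

/-- **`A ⟹ λ_m = 0` for every `m ≥ 1`.** -/
theorem kiKimLee_const_eq_zero_of_rowsFromOne
    (hA : ∀ d n : ℕ, 1 ≤ n → (jensenPoly xiTaylorCoeff d n).Splits) (m : ℕ) (hm : 1 ≤ m) :
    sInf {t : ℝ | HasOnlyRealZeros (iteratedDeriv m (deBruijnH t))} = 0 :=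
  kiKimLee_const_eq_zero_of_hasOnlyRealZeros m
    ((rowsFromOne_iff_forall_hasOnlyRealZeros_iteratedDeriv.1 hA) m hm)

/-- **`A ⟺ λ_1-set contains `0` ⟺ H_0′ hyperbolic**, restated with the flow facts side by side:
`A` holds iff `0 ∈ {t | H_t′ hyperbolic}`, a set contained in `[0, ∞)` (G6.5) and containing `1/2`. -/
theorem rowsFromOne_iff_zero_mem :
    (∀ d n : ℕ, 1 ≤ n → (jensenPoly xiTaylorCoeff d n).Splits) ↔
      (0 : ℝ) ∈ {t : ℝ | HasOnlyRealZeros (iteratedDeriv 1 (deBruijnH t))} := by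
  rw [rowsFromOne_iff_hasOnlyRealZeros_deriv_deBruijnH_zero, Set.mem_setOf_eq, iteratedDeriv_one]

/-- **X-4's conjunct `A` ⟺ `λ_1 = 0`** (the first Ki–Kim–Lee constant vanishes; attained by G6.8). -/
theorem rowsFromOne_iff_kiKimLee_const_one_eq_zero :
    (∀ d n : ℕ, 1 ≤ n → (jensenPoly xiTaylorCoeff d n).Splits) ↔
      sInf {t : ℝ | HasOnlyRealZeros (iteratedDeriv 1 (deBruijnH t))} = 0 := by
  rw [rowsFromOne_iff_hasOnlyRealZeros_deriv_deBruijnH_zero, ← iteratedDeriv_one,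
    hasOnlyRealZeros_iteratedDeriv_zero_iff_kiKimLee_const_eq_zero]

/-- **X-4's conjunct `A` ⟺ `λ_1 ≤ 0`**, side by side with the tree's `RH ⟺ λ_0 = Λ ≤ 0`. -/
theorem rowsFromOne_iff_kiKimLee_const_one_nonpos :
    (∀ d n : ℕ, 1 ≤ n → (jensenPoly xiTaylorCoeff d n).Splits) ↔
      sInf {t : ℝ | HasOnlyRealZeros (iteratedDeriv 1 (deBruijnH t))} ≤ 0 := by
  rw [rowsFromOne_iff_kiKimLee_const_one_eq_zero, kiKimLee_const_nonpos_iff_eq_zero]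

/-- **The neg-lens reading of X-4, kernel form: `A ∧ ¬RH ⟺ (λ_1 = 0 ∧ 0 < Λ)`** — conjunct `A` could
hold without RH exactly if the Ki–Kim–Lee chain `0 ≤ λ_1 ≤ λ_0 = Λ` dropped STRICTLY to its floor at
the first step.  (No claim about which side holds.) -/
theorem rowsFromOne_and_not_rh_iff :
    ((∀ d n : ℕ, 1 ≤ n → (jensenPoly xiTaylorCoeff d n).Splits) ∧ ¬ _root_.RiemannHypothesis) ↔
      (sInf {t : ℝ | HasOnlyRealZeros (iteratedDeriv 1 (deBruijnH t))} = 0 ∧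
        0 < deBruijnNewmanConst) := by
  rw [rowsFromOne_iff_kiKimLee_const_one_eq_zero, riemannHypothesis_iff_deBruijnNewmanConst_nonpos, not_le]

/-- **X-4 restated on the flow: `RH ⟺ (λ_1 = 0) ∧ B`** (`B = RowZeroLaguerre`), from the tree's
`rh_iff_rowsFromOne_and_rowZeroLaguerre`-shaped splitting supplied as a hypothesis-free rewrite of `A`. -/
theorem rh_iff_kiKimLee_const_one_eq_zero_and (B : Prop)
    (hX4 : _root_.RiemannHypothesis ↔ (∀ d n : ℕ, 1 ≤ n → (jensenPoly xiTaylorCoeff d n).Splits) ∧ B) :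
    _root_.RiemannHypothesis ↔
      sInf {t : ℝ | HasOnlyRealZeros (iteratedDeriv 1 (deBruijnH t))} = 0 ∧ B := by
  rw [hX4, rowsFromOne_iff_kiKimLee_const_one_eq_zero]

end SplittingX4

end Summit.RiemannHypothesis.RiemannHypothesis.Theorems.Splittings.JensenX4NewmanAllDeriv

end
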